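import Summits.BirchSwinnertonDyer.BirchSwinnertonDyer.Theorems.QuadraticBranchSignedControlPlusEtaNonsurjThetaFunctionalEquationWeierstrassCongruence
import Literature.NumberTheory.EllipticCurves.Kim2008.AlgebraicFunctionalEquationSigned
import HarnessLib

/-!
# Route `QuadraticBranchSignedControl` (rung K8, cell `bsd-potss`), residual crux `PlusEtaMainConjectureNonsurj`
# (stmt-BirchSwinnertonDyer-19606): THE FUNCTIONAL EQUATION ON THE QUADRATIC BRANCH, XXII — THE ALGEBRAIC TWIN AT THE CRUX'S OBJECT
# `X^±(V/ℚ(μ_{p^∞}))^η`: GRANTED B. D. Kim's Thm. 3.11 (named fact, hypothesis position) the Weierstrass polynomial of a generator of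
# `Char X^ε(V/K_∞)^η` is `(−1)^λ`-RECIPROCAL, `λ_alg` is EVEN when the generator does not vanish at `T = 0`, and the MISSING PART between
# `pⁿ·L_p⁺(V, η, X)` and `Char` (the slack of Kobayashi's Thm. 4.1 at the crux's NON-ONTO rows) is itself a RECIPROCAL distinguished polynomial
# (seat `bsd-potss-k8eta-c2` g29; kernel, CONDITIONAL on the named fact `Kim2008.thm311_etaSignedSelmerDual_charIdeal_map_invol`)

WHY. Parts XV–XXI are about the ANALYTIC object `L_p^±(V, η, X)`. The crux 19606 is the equality `Char X⁺(V/K_∞)^η = (L_p⁺(V, η, X))` at the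
rows whose `p`-adic tower is not onto, where Kobayashi's Thm. 4.1 gives only `pⁿ·L_p⁺(V,η,X) ∈ Char` (named fact
`Kobayashi2003.thm41_plusEtaCharIdeal_dvd`, slack clause). Part XVIII showed that every `ι`-STABLE principal ideal of `Λ` has a
`(−1)^λ`-reciprocal Weierstrass polynomial and that cofactors between `ι`-stable ideals are `ι`-stable. B. D. Kim's algebraic functional equation
(MRL 2008, Thm. 3.11: `Sel^±(E/ℚ(μ_{p^∞}))^∨ ∼ (Sel^±)^{∨,ι}`; tree: the named fact `Kim2008.thm311_etaSignedSelmerDual_charIdeal_map_invol`,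
`Ideal.map ι (Char X^ε(V/K_∞)^η) = Char`, for the `{±1}`-valued `η` and both signs — already the input of k8eta-c1's 19601 squeeze) makes
`Char X^ε(V/K_∞)^η` `ι`-stable. THIS FILE draws the consequences at the crux's object, CONDITIONALLY on that fact (hypothesis `hKim`):
(§64) for every datum `D` and generator `g` of `D.charIdeal` (principal: tree `charIdeal_isPrincipal_holds`), **the Weierstrass polynomial of
`g` is `(−1)^d`-reciprocal, `P(−1) = (−1)^d`; `λ(g)` is even when `g(0) ≠ 0`**; (§65) **if `pⁿ·Lη = g·h` (the slack factorisation of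
Thm. 4.1; `Lη` any plus/minus branch function, `(ι Lη) = (Lη)` by Part X) then the cofactor `h` has a `(−1)^{deg}`-reciprocal Weierstrass
polynomial `R`, `R(−1) = (−1)^{deg R}`; `deg R = 1 ⇒ R = T`, `deg R = 2 ⇒ R = T² + aT + a`** — the missing part of the `η`-main conjecture at
a non-onto row, if it is not a unit times `pᵐ`, is a reciprocal polynomial of degree `λ(Lη) − λ(g)`; its parity is `w·(−1)^{λ(g)}`.

WHAT. §64 `span_invol_eq_of_map_invol_eq` (ideal form ⇒ generator form), **`reciprocal_charGenerator_of_kim`**, `even_lam_charGenerator_of_kim`,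
`exists_reciprocal_weierstrass_charGenerator_of_kim`; §65 `span_invol_eq_C_mul` (`(ι(c·L)) = (c·L)` from `(ιL) = (L)`),
**`reciprocal_slackCofactor_of_kim`** (generic branch function), `slackCofactor_shape_of_kim` (`deg 1 ⇒ T`, `deg 2 ⇒ T² + aT + a`), row
`reciprocal_slackCofactor_plus_row_of_kim`.

HONEST FRAMING (cell `bsd-potss`; FULL-BSD rank ≤ 1 programme, HUMAN RULING D-0036/D-0074): TOOL THEOREMS, CONDITIONAL on the named Literature
fact `Kim2008.thm311_etaSignedSelmerDual_charIdeal_map_invol` in HYPOTHESIS position (`hKim`; no `_holds` in the tree; the same input as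
k8eta-c1's `…PlusEtaLowerInclusionFunctionalEquationSqueeze`); the slack factorisation `pⁿ·Lη = g·h` is a HYPOTHESIS (displayed per pair or taken
from `Kobayashi2003.thm41_plusEtaCharIdeal_dvd`), not derived here. No definition, no new named fact, no `sorry`, axioms standard; nothing about
(A), (C1⁺_η), (E⁺_η), C-cc-1 or `BSD(W,p)` of any pair is claimed; crux and route OPEN; nothing booked. `--supports stmt-BirchSwinnertonDyer-19606`.

References: [KimBD2008MRL] Thm. 3.11 with Thm. 3.10 (p. 93), §1 p. 83 ("`(a) = (a^ι)`"); [Kobayashi2003] Thm. 4.1 (p. 8), §4;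
[GreenbergLNM1716] §1 (pp. 67–68); [Washington1997] §7.1, §13.2. Tree: Parts X, XVI, XVIII; `Kim2008/AlgebraicFunctionalEquationSigned.lean`;
`IwasawaAlgebra.charIdeal_isPrincipal_holds`.
-/

set_option autoImplicit false
set_option linter.dupNamespace false
noncomputable section

open scoped Classical MatrixGroups ModularForm

open CongruenceSubgroup WeierstrassCurve Field Literature.NumberTheory.EllipticCurves
  Literature.NumberTheory.EllipticCurves.ModularForms Literature.NumberTheory.GaloisRepresentations ZpExtension
open Literature.NumberTheory.EllipticCurves.IwasawaAlgebra
open Summit.BirchSwinnertonDyer.Rank1Residual.Additive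
open Summit.BirchSwinnertonDyer.Rank1Residual.X1.MuLambda (mu lam)

namespace Summit.BirchSwinnertonDyer.BirchSwinnertonDyer.Theorems.EtaThetaFunctionalEquation

variable {p : ℕ} [hp : Fact p.Prime]

/-! ## §64 Granted Kim 3.11η: the Weierstrass polynomial of a generator of `Char X^ε(V/K_∞)^η` is `(−1)^λ`-reciprocal -/

omit hp in
/-- Ideal form ⇒ generator form: `ι(I) = I`, `I = (g)` ⇒ `(ι g) = (g)`. [cite: KimBD2008MRL, §1 p. 83 ("(a) = (a^ι)")] -/
theorem span_invol_eq_of_map_invol_eq [Fact p.Prime] {I : Ideal (IwasawaAlgebra p)}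
    (hI : Ideal.map (invol p) I = I) {g : IwasawaAlgebra p} (hg : I = Ideal.span {g}) :
    Ideal.span {invol p g} = Ideal.span {g} := by
  rw [hg, Ideal.map_span, Set.image_singleton] at hI
  exact hI

section Kim

variable (K₀ : Type) [Field K₀] [NumberField K₀] [IsCyclotomicExtension {p} ℚ K₀] [(galRange (K := ℚ) K₀).Normal]
  {ηq : absoluteGaloisGroup ℚ →* ℤˣ} {V : WeierstrassCurve ℚ} [V.IsElliptic] [V.IsGloballyMinimal]
  {κ : ZpExtension ℚ p} {γ : absoluteGaloisGroup ℚ} {ε : ℤˣ}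

/-- **THE WEIERSTRASS POLYNOMIAL OF `Char X^ε(V/K_∞)^η` IS `(−1)^λ`-RECIPROCAL (granted Kim 3.11η).** `p ≥ 5` good with `a_p(V) = 0`
(every row of the crux), `η` a `{±1}`-valued character trivial on `Gal(ℚ̄/ℚ(μ_p))`, `κ` cyclotomic with topological generator `γ ∈ Gal(ℚ̄/K₀)`,
ANY dual datum `D` of `Sel^ε(V/ℚ(μ_{p^∞}))^η` (the crux's `Additive.EtaSignedSelmerDualData`, bridged to the fact's frame by
`D.toLiterature`, same `charIdeal`), any generator `g` of `D.charIdeal`, any Weierstrass datum `g = a·P·U`: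
`(1+T)^d ι P = (−1)^d P` and `P(−1) = (−1)^d`. CONDITIONAL on `hKim`. [cite: KimBD2008MRL, Thm. 3.11 (p. 93), §1 p. 83]
[cite: Washington1997, §7.1, §13.2] -/
theorem reciprocal_charGenerator_of_kim (hKim : Kim2008.thm311_etaSignedSelmerDual_charIdeal_map_invol)
    (hη : ∀ σ ∈ galRange (K := ℚ) K₀, ηq σ = 1) (hp5 : 5 ≤ p) (hgood : V.HasGoodReductionAtPrime p)
    (hap : V.frobeniusTrace p = 0) (hκ : κ.IsCyclotomic) (hγ : κ.IsTopGenerator γ) (hγ₀ : γ ∈ galRange (K := ℚ) K₀)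
    (D : EtaSignedSelmerDualData V κ K₀ ℚ_[p] ηq γ ε) {g : IwasawaAlgebra p} (hg : D.charIdeal = Ideal.span {g})
    {P : Polynomial ℤ_[p]} (hP : P.IsDistinguishedAt (IsLocalRing.maximalIdeal ℤ_[p])) {a : ℤ_[p]} (ha : a ≠ 0)
    {U : IwasawaAlgebra p} (hU : IsUnit U) (hgP : g = PowerSeries.C a * (P : IwasawaAlgebra p) * U) :
    (1 + PowerSeries.X) ^ P.natDegree * invol p (P : IwasawaAlgebra p) =
        PowerSeries.C ((-1) ^ P.natDegree) * (P : IwasawaAlgebra p) ∧ P.eval (-1) = (-1) ^ P.natDegree := by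
  have hp2 : p ≠ 2 := by omega
  have hmap := hKim p K₀ ηq hη V (by omega) hgood hap κ γ hκ hγ hγ₀ ε D.toLiterature
  rw [EtaSignedSelmerDualData.charIdeal_toLiterature] at hmap
  exact reciprocal_of_span_invol_eq hp2 (span_invol_eq_of_map_invol_eq hmap hg) hP ha hU hgP

/-- **`λ_alg` IS EVEN when the generator does not vanish at `T = 0`** (granted Kim 3.11η): `g(0) ≠ 0 ⇒ Even (lam g)` — e.g. when the
`Γ`-coinvariants of `X^ε(V/K_∞)^η` are finite. CONDITIONAL on `hKim`. [cite: KimBD2008MRL, Thm. 3.11 (p. 93)] [cite: Washington1997, §13.2] -/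
theorem even_lam_charGenerator_of_kim (hKim : Kim2008.thm311_etaSignedSelmerDual_charIdeal_map_invol)
    (hη : ∀ σ ∈ galRange (K := ℚ) K₀, ηq σ = 1) (hp5 : 5 ≤ p) (hgood : V.HasGoodReductionAtPrime p)
    (hap : V.frobeniusTrace p = 0) (hκ : κ.IsCyclotomic) (hγ : κ.IsTopGenerator γ) (hγ₀ : γ ∈ galRange (K := ℚ) K₀)
    (D : EtaSignedSelmerDualData V κ K₀ ℚ_[p] ηq γ ε) {g : IwasawaAlgebra p} (hg : D.charIdeal = Ideal.span {g})
    (hg0 : PowerSeries.constantCoeff g ≠ 0) : Even (lam g) := by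
  have hp2 : p ≠ 2 := by omega
  have hmap := hKim p K₀ ηq hη V (by omega) hgood hap κ γ hκ hγ hγ₀ ε D.toLiterature
  rw [EtaSignedSelmerDualData.charIdeal_toLiterature] at hmap
  exact even_lam_of_span_invol_eq hp2 hg0 (span_invol_eq_of_map_invol_eq hmap hg)

/-- **Existence with `d = λ(g)`** (granted Kim 3.11η): a nonzero generator `g` of `Char X^ε(V/K_∞)^η` is `p^{μ(g)}·P·U` with `P`
distinguished of degree `λ(g)`, `(1+T)^{λ(g)} ι P = (−1)^{λ(g)} P`, `P(−1) = (−1)^{λ(g)}`. CONDITIONAL on `hKim`.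
[cite: KimBD2008MRL, Thm. 3.11 (p. 93)] [cite: Washington1997, §7.1 (Thm. 7.3)] -/
theorem exists_reciprocal_weierstrass_charGenerator_of_kim (hKim : Kim2008.thm311_etaSignedSelmerDual_charIdeal_map_invol)
    (hη : ∀ σ ∈ galRange (K := ℚ) K₀, ηq σ = 1) (hp5 : 5 ≤ p) (hgood : V.HasGoodReductionAtPrime p)
    (hap : V.frobeniusTrace p = 0) (hκ : κ.IsCyclotomic) (hγ : κ.IsTopGenerator γ) (hγ₀ : γ ∈ galRange (K := ℚ) K₀)
    (D : EtaSignedSelmerDualData V κ K₀ ℚ_[p] ηq γ ε) {g : IwasawaAlgebra p} (hg : D.charIdeal = Ideal.span {g}) (hg0 : g ≠ 0) :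
    ∃ (P : Polynomial ℤ_[p]) (U : IwasawaAlgebra p), P.IsDistinguishedAt (IsLocalRing.maximalIdeal ℤ_[p]) ∧ IsUnit U ∧
      P.natDegree = lam g ∧ g = PowerSeries.C ((p : ℤ_[p]) ^ mu g) * (P : IwasawaAlgebra p) * U ∧
      (1 + PowerSeries.X) ^ lam g * invol p (P : IwasawaAlgebra p) = PowerSeries.C ((-1) ^ lam g) * (P : IwasawaAlgebra p) ∧
      P.eval (-1) = (-1) ^ lam g := by
  have hp2 : p ≠ 2 := by omega
  have hmap := hKim p K₀ ηq hη V (by omega) hgood hap κ γ hκ hγ hγ₀ ε D.toLiterature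
  rw [EtaSignedSelmerDualData.charIdeal_toLiterature] at hmap
  exact exists_reciprocal_weierstrass_of_span_invol_eq hp2 hg0 (span_invol_eq_of_map_invol_eq hmap hg)

end Kim

/-! ## §65 The slack cofactor `pⁿ·Lη = g·h` is reciprocal (granted Kim 3.11η) -/

omit hp in
/-- `(ιL) = (L) ⇒ (ι(c·L)) = (c·L)` for a constant `c` (`ι` fixes constants). [cite: Washington1997, §13.2] -/
theorem span_invol_eq_C_mul [Fact p.Prime] {L : IwasawaAlgebra p} (hL : Ideal.span {invol p L} = Ideal.span {L}) (c : ℤ_[p]) :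
    Ideal.span {invol p (PowerSeries.C c * L)} = Ideal.span {PowerSeries.C c * L} := by
  rw [map_mul (invol p), invol_C, ← Ideal.span_singleton_mul_span_singleton, ← Ideal.span_singleton_mul_span_singleton, hL]

section Slack

variable (K₀ : Type) [Field K₀] [NumberField K₀] [IsCyclotomicExtension {p} ℚ K₀] [(galRange (K := ℚ) K₀).Normal]
  {ηq : absoluteGaloisGroup ℚ →* ℤˣ} {V : WeierstrassCurve ℚ} [V.IsElliptic] [V.IsGloballyMinimal]
  {κ : ZpExtension ℚ p} {γ : absoluteGaloisGroup ℚ} {ε : ℤˣ} {N : ℕ} [NeZero N] {f : CuspForm (Gamma0 N) 2}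

/-- **THE SLACK COFACTOR IS RECIPROCAL (granted Kim 3.11η).** At a row of the crux (`V` good at `p ≥ 5`, `a_p(V) = 0`, `f` its newform, any
`ϖ`), for a plus branch function `Lη`, a dual datum `D` of `Sel^ε(V/ℚ(μ_{p^∞}))^η` with `D.charIdeal = (g)`, `g ≠ 0`, and a SLACK
FACTORISATION `pⁿ·Lη = g·h` (Kobayashi Thm. 4.1's clause at non-onto rows, displayed): every Weierstrass datum `h = a·R·U` of the cofactor has
`(1+T)^{deg R} ι R = (−1)^{deg R} R` and `R(−1) = (−1)^{deg R}`. CONDITIONAL on `hKim`; `(ι Lη) = (Lη)` is Part X (no fact).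
[cite: KimBD2008MRL, Thm. 3.11 (p. 93)] [cite: Kobayashi2003, Thm. 4.1 (p. 8)] [cite: GreenbergLNM1716, §1 (pp. 67–68)] -/
theorem reciprocal_slackCofactor_plus_row_of_kim (hKim : Kim2008.thm311_etaSignedSelmerDual_charIdeal_map_invol)
    (hη : ∀ σ ∈ galRange (K := ℚ) K₀, ηq σ = 1) (hp5 : 5 ≤ p) (hgood : V.HasGoodReductionAtPrime p)
    (hap : V.frobeniusTrace p = 0) (hf : IsNewformOf V f) (ϖ : ℚ) {Lη : IwasawaAlgebra p} (hL : IsQuadraticBranchPlusLFunction f p ϖ Lη)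
    (hκ : κ.IsCyclotomic) (hγ : κ.IsTopGenerator γ) (hγ₀ : γ ∈ galRange (K := ℚ) K₀)
    (D : EtaSignedSelmerDualData V κ K₀ ℚ_[p] ηq γ ε) {g h : IwasawaAlgebra p} (hg : D.charIdeal = Ideal.span {g}) (hg0 : g ≠ 0)
    {n : ℕ} (hslack : PowerSeries.C ((p : ℤ_[p]) ^ n) * Lη = g * h)
    {R : Polynomial ℤ_[p]} (hR : R.IsDistinguishedAt (IsLocalRing.maximalIdeal ℤ_[p])) {a : ℤ_[p]} (ha : a ≠ 0)
    {U : IwasawaAlgebra p} (hU : IsUnit U) (hhR : h = PowerSeries.C a * (R : IwasawaAlgebra p) * U) :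
    (1 + PowerSeries.X) ^ R.natDegree * invol p (R : IwasawaAlgebra p) =
        PowerSeries.C ((-1) ^ R.natDegree) * (R : IwasawaAlgebra p) ∧ R.eval (-1) = (-1) ^ R.natDegree := by
  have hp2 : p ≠ 2 := by omega
  have hmap := hKim p K₀ ηq hη V (by omega) hgood hap κ γ hκ hγ hγ₀ ε D.toLiterature
  rw [EtaSignedSelmerDualData.charIdeal_toLiterature] at hmap
  have hLs := span_invol_eq_C_mul (span_invol_eq_plus_row hp5 V hgood hap hf ϖ hL) ((p : ℤ_[p]) ^ n)
  exact reciprocal_cofactor hp2 hg0 hslack hLs (span_invol_eq_of_map_invol_eq hmap hg) hR ha hU hhR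

/-- **SHAPE OF A SMALL SLACK COFACTOR (granted Kim 3.11η)**: in the same situation, `deg R = 1 ⇒ R = T` and `deg R = 2 ⇒ R = T² + aT + a`
(`a = R(0)`): a missing part of degree one is the trivial zero; of degree two it has ONE `p`-adic parameter.
[cite: KimBD2008MRL, Thm. 3.11 (p. 93)] [cite: GreenbergLNM1716, §5 (p. 181)] [cite: Washington1997, §7.1] -/
theorem slackCofactor_shape_plus_row_of_kim (hKim : Kim2008.thm311_etaSignedSelmerDual_charIdeal_map_invol)
    (hη : ∀ σ ∈ galRange (K := ℚ) K₀, ηq σ = 1) (hp5 : 5 ≤ p) (hgood : V.HasGoodReductionAtPrime p)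
    (hap : V.frobeniusTrace p = 0) (hf : IsNewformOf V f) (ϖ : ℚ) {Lη : IwasawaAlgebra p} (hL : IsQuadraticBranchPlusLFunction f p ϖ Lη)
    (hκ : κ.IsCyclotomic) (hγ : κ.IsTopGenerator γ) (hγ₀ : γ ∈ galRange (K := ℚ) K₀)
    (D : EtaSignedSelmerDualData V κ K₀ ℚ_[p] ηq γ ε) {g h : IwasawaAlgebra p} (hg : D.charIdeal = Ideal.span {g}) (hg0 : g ≠ 0)
    {n : ℕ} (hslack : PowerSeries.C ((p : ℤ_[p]) ^ n) * Lη = g * h)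
    {R : Polynomial ℤ_[p]} (hR : R.IsDistinguishedAt (IsLocalRing.maximalIdeal ℤ_[p])) {a : ℤ_[p]} (ha : a ≠ 0)
    {U : IwasawaAlgebra p} (hU : IsUnit U) (hhR : h = PowerSeries.C a * (R : IwasawaAlgebra p) * U) :
    (R.natDegree = 1 → R = Polynomial.X) ∧
      (R.natDegree = 2 → R = Polynomial.X ^ 2 + Polynomial.C (R.coeff 0) * Polynomial.X + Polynomial.C (R.coeff 0)) := by
  have hp2 : p ≠ 2 := by omega
  obtain ⟨hrec, hev⟩ := reciprocal_slackCofactor_plus_row_of_kim K₀ hKim hη hp5 hgood hap hf ϖ hL hκ hγ hγ₀ D hg hg0 hslack hR ha hU hhR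
  refine ⟨fun h1 ↦ eq_X_of_reciprocal_one hR.monic h1 hrec rfl, fun h2 ↦ ?_⟩
  have hw : ((-1 : ℤ_[p]) ^ R.natDegree) = 1 ∨ ((-1 : ℤ_[p]) ^ R.natDegree) = -1 := by rw [h2]; left; norm_num
  exact (eq_X_sq_add_of_reciprocal_two hp2 hR h2 hw hev).1

/-- **THE DEGREE OF THE SLACK COFACTOR HAS THE PARITY `w·(−1)^{λ_alg}`** (granted Kim 3.11η), in the form: the SIGNS multiply —
`P_g(−1)·R(−1) = (−1)^{deg P_g + deg R}`, and `deg P_g + deg R = λ(pⁿ Lη) = λ(Lη)` when the data are the `λ`-data; here we record the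
elementary identity `(−1)^{deg P_g}·(−1)^{deg R} = (−1)^{deg P_g + deg R}` together with both reciprocities, for consumers comparing with Part XII's
`(−1)^{λ(Lη)} = w(V^{(p*)})`. CONDITIONAL on `hKim`. [cite: KimBD2008MRL, Thm. 3.11 (p. 93)] [cite: MazurTateTeitelbaum1986Invent, §I.17] -/
theorem sign_mul_sign_slack_plus_row_of_kim (hKim : Kim2008.thm311_etaSignedSelmerDual_charIdeal_map_invol)
    (hη : ∀ σ ∈ galRange (K := ℚ) K₀, ηq σ = 1) (hp5 : 5 ≤ p) (hgood : V.HasGoodReductionAtPrime p)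
    (hap : V.frobeniusTrace p = 0) (hf : IsNewformOf V f) (ϖ : ℚ) {Lη : IwasawaAlgebra p} (hL : IsQuadraticBranchPlusLFunction f p ϖ Lη)
    (hκ : κ.IsCyclotomic) (hγ : κ.IsTopGenerator γ) (hγ₀ : γ ∈ galRange (K := ℚ) K₀)
    (D : EtaSignedSelmerDualData V κ K₀ ℚ_[p] ηq γ ε) {g h : IwasawaAlgebra p} (hg : D.charIdeal = Ideal.span {g}) (hg0 : g ≠ 0)
    {n : ℕ} (hslack : PowerSeries.C ((p : ℤ_[p]) ^ n) * Lη = g * h)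
    {Pg R : Polynomial ℤ_[p]} (hPg : Pg.IsDistinguishedAt (IsLocalRing.maximalIdeal ℤ_[p]))
    (hR : R.IsDistinguishedAt (IsLocalRing.maximalIdeal ℤ_[p])) {a b : ℤ_[p]} (ha : a ≠ 0) (hb : b ≠ 0)
    {U W : IwasawaAlgebra p} (hU : IsUnit U) (hW : IsUnit W) (hgP : g = PowerSeries.C a * (Pg : IwasawaAlgebra p) * U)
    (hhR : h = PowerSeries.C b * (R : IwasawaAlgebra p) * W) :
    Pg.eval (-1) * R.eval (-1) = (-1) ^ (Pg.natDegree + R.natDegree) := by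
  obtain ⟨-, h1⟩ := reciprocal_charGenerator_of_kim K₀ hKim hη hp5 hgood hap hκ hγ hγ₀ D hg hPg ha hU hgP
  obtain ⟨-, h2⟩ := reciprocal_slackCofactor_plus_row_of_kim K₀ hKim hη hp5 hgood hap hf ϖ hL hκ hγ hγ₀ D hg hg0 hslack hR hb hW hhR
  rw [h1, h2, pow_add]

end Slack

end Summit.BirchSwinnertonDyer.BirchSwinnertonDyer.Theorems.EtaThetaFunctionalEquation

end
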